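import Mathlib.Geometry.Manifold.Instances.Icc
import Literature.Geometry.Lorentzian.CauchyDevelopment
import Literature.Geometry.Lorentzian.AsymptoticFlatness
import HarnessLib

/-!
# Normalised maximal Cauchy foliations, the lapse, and trapped lapse wells

A time-oriented Lorentzian `4`-manifold `(M, g, τ)` (`Spacetime 4`) is said to carry a
**normalised maximal Cauchy foliation** modelled on the `3`-manifold `X` when there is a map
`F : ℝ × X → M`, `(t, x) ↦ F(t, x)`, together with the future unit normals `ν t` of its leaves
`Σ_t = F({t} × X)`, such that

* `F` is smooth and every leaf map `x ↦ F(t, x)` is a smooth embedding of `X` onto a Cauchy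
  hypersurface `Σ_t` of `(M, g, τ)` with future unit normal `ν t`;
* the data `(h_t, k_t)` induced on `X` by the leaf `Σ_t` (pullback metric, second fundamental
  form w.r.t. `ν t`, sign `K_ν(v, w) = + g(D_v ν, dF w)` as in `DataEmbedding`) form an initial
  data set which is **maximal** (`tr_h k = 0`, `InitialDataSet.IsMaximalData`), **complete**, and
  **asymptotically flat of order `1` with a sole end** (`AFEnd.IsSoleEnd`,
  `AFEnd.IsAsymptoticallyFlat _ 1`);
* the **lapse** `N(t, x) = -g(∂ₜF, ν)` (`Spacetime.lapseOf`; Wald 1984, (10.2.11):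
  `N = -t^a n_a` for the time-flow field `t^a = ∂ₜF`) is positive, and `N(t, ·) → 1` at spatial
  infinity (along `Filter.cocompact X`) on every leaf `t ≥ 0` — the *normal foliation condition*
  of Christodoulou–Klainerman.

This is the gauge of Christodoulou–Klainerman 1993, Introduction, (1.0.1)–(1.0.2) (lapse of a
time foliation), the "Normal Foliation Condition" `φ → 1` at infinity on each leaf, and
(1.0.10)–(1.0.13) (maximal foliation `tr k = 0`, lapse equation `Δφ = |k|² φ`); cf. Bartnik,
Comm. Math. Phys. 94 (1984) 155 (existence of maximal surfaces in asymptotically flat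
spacetimes). We allow a general flow field `∂ₜF = N ν + shift` (Wald 1984, (10.2.11)–(10.2.12)),
Christodoulou–Klainerman's parametrisation along the normals being the zero-shift case.

The companion predicate `Spacetime.HasTrappedWells` ("the lapse wells are trapped") says: for
some `ε > 0` and `t₀`, from time `t₀` on, a point of a leaf where the lapse has collapsed below
`ε` cannot causally reach the region `{N > 1 - ε}` of any later leaf. The phenomenon it
abstracts is the *collapse of the lapse* of maximal slicings inside black holes (Beig–Ó Murchadha,
Phys. Rev. D 57 (1998) 4728, §IV: late-time maximal slices of Schwarzschild pile up on the limit
cylinder `r = 3M/2` with lapse decaying exponentially); the predicate itself is the clause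
"wells trapped" of route `LapseTrumpetKID` of the Final State Conjecture, vendored here so that
the route's items can be stated by name.

## Design

* The three notions are predicates/functions of a bundled `𝓢 : Spacetime 4`, the map `F` and
  the normals `ν`; for a (vacuum) Cauchy development `𝒟 : VacuumCauchyDevelopment D`
  (`CauchyDevelopment.lean`) one writes `𝒟.IsNormalisedMaximalFoliation F ν`,
  `𝒟.lapseOf F ν t x`, `𝒟.HasTrappedWells F ν` (generalised field notation through the
  `extends` chain `VacuumCauchyDevelopment → CauchyDevelopment → DataEmbedding → Spacetime`), or
  `𝒟.toSpacetime.IsNormalisedMaximalFoliation F ν`.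
* `IsNormalisedMaximalFoliation` is a plain conjunction, *verbatim* the inline clause used by the
  route items (with the lapse spelled `lapseOf`), so that those items restate *definitionally*:
  the unfolding lemmas `isNormalisedMaximalFoliation_iff`, `hasTrappedWells_iff`, `lapseOf_def`
  are proved by `Iff.rfl`/`rfl` against the fully inlined forms. Named projections
  (`IsNormalisedMaximalFoliation.contMDiff`, `….isCauchyHypersurface`, `….lapseOf_pos`, …) are
  provided for provers.
* The leaf data are quantified existentially (`∃ Dt : InitialDataSet (𝓡 3) X, …`) exactly as in
  the route: the induced metric and second fundamental form *agree with* some initial data set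
  on `X` having the listed properties (the instance binder `[g.HasLeviCivita]` of
  `secondFundamentalForm` and `[h.HasLeviCivita]` of `IsComplete` are bound innermost, as in
  `DataEmbedding.induced_k`).
* Nothing here asserts existence: whether a given development carries such a foliation is the
  content of the maximal-slicing existence/avoidance theorems (Bartnik 1984; Eardley–Smarr 1979;
  Beig–Ó Murchadha 1998), not of this file.

## References

* D. Christodoulou, S. Klainerman, *The Global Nonlinear Stability of the Minkowski Space*,
  Princeton Math. Series 41 (1993), Introduction, (1.0.1)–(1.0.2), (1.0.10)–(1.0.13).
* R. M. Wald, *General Relativity* (1984), §10.2, (10.2.11)–(10.2.12).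
* R. Beig, N. Ó Murchadha, *Late time behavior of the maximal slicing of the Schwarzschild black
  hole*, Phys. Rev. D 57 (1998) 4728–4737, §IV.
* R. Bartnik, *Existence of maximal surfaces in asymptotically flat spacetimes*, Comm. Math.
  Phys. 94 (1984) 155–175.
-/

noncomputable section

open Manifold Bundle Set Filter TopologicalSpace
open scoped ContDiff Topology

universe u

namespace Literature.Geometry.Lorentzian

namespace Spacetime

variable (𝓢 : Spacetime.{u} 4) {X : Type*}

section Lapse

/-- The **lapse** of the foliation map `F : ℝ × X → M` with respect to the normals `ν`:
`N(t, x) = -g_{F(t,x)}(∂ₜF(t, x), ν_t(x))`, where `∂ₜF(t, x) = d(s ↦ F(s, x))_t(1)` is the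
velocity of the flow line through `x`. For the future unit normal `ν` of the leaves and
signature `(-, +, +, +)` this is Wald's `N = -t^a n_a` with time-flow field `t^a = ∂ₜF`; in
Christodoulou–Klainerman's normal parametrisation (zero shift) `∂ₜF = φ T` and `N = φ`.
[cite: Wald1984, (10.2.11)] -/
def lapseOf (F : ℝ × X → 𝓢.carrier) (ν : ∀ t : ℝ, NormalField (𝓡 4) (fun x : X ↦ F (t, x)))
    (t : ℝ) (x : X) : ℝ :=
  - 𝓢.metric.val (F (t, x)) (mfderiv 𝓘(ℝ, ℝ) (𝓡 4) (fun s : ℝ ↦ F (s, x)) t 1) (ν t x)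

variable {𝓢} in
/-- Unfolding lemma: `lapseOf 𝓢 F ν t x = -g(∂ₜF(t, x), ν_t(x))`. [cite: Wald1984, (10.2.11)] -/
theorem lapseOf_def (F : ℝ × X → 𝓢.carrier)
    (ν : ∀ t : ℝ, NormalField (𝓡 4) (fun x : X ↦ F (t, x))) (t : ℝ) (x : X) :
    𝓢.lapseOf F ν t x =
      - 𝓢.metric.val (F (t, x)) (mfderiv 𝓘(ℝ, ℝ) (𝓡 4) (fun s : ℝ ↦ F (s, x)) t 1) (ν t x) :=
  rfl

end Lapse

section Foliation

variable [TopologicalSpace X] [ChartedSpace E3 X] [IsManifold (𝓡 3) ∞ X]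

/-- `(F, ν)` is a **normalised maximal Cauchy foliation** of the spacetime `𝓢 = (M, g, τ)`
modelled on the `3`-manifold `X`: `F : ℝ × X → M` is smooth; every leaf map `x ↦ F(t, x)` is a
smooth embedding whose image is a Cauchy hypersurface, with future unit normal `ν t`; the induced
metric `F_t^* g` and second fundamental form `K_{ν t}` agree with an initial data set `(h, k)` on
`X` which is maximal (`tr_h k = 0`), complete, and asymptotically flat of order `1` with a sole
end; the lapse `N = -g(∂ₜF, ν)` (`lapseOf`) is positive everywhere and `N(t, ·) → 1` at spatial
infinity (`Filter.cocompact X`) on every leaf `t ≥ 0`. Christodoulou–Klainerman 1993,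
Introduction: lapse (1.0.1), "Normal Foliation Condition" (`φ → 1` as `x → ∞` on each leaf
`Σ_t`), maximal foliation (1.0.10)–(1.0.13). Stated as a conjunction, verbatim the clause of
route `LapseTrumpetKID` (`isNormalisedMaximalFoliation_iff`).
[cite: ChristodoulouKlainerman1993, Introduction, (1.0.1) and (1.0.10)–(1.0.13)] -/
def IsNormalisedMaximalFoliation (F : ℝ × X → 𝓢.carrier)
    (ν : ∀ t : ℝ, NormalField (𝓡 4) (fun x : X ↦ F (t, x))) : Prop :=
  ContMDiff (𝓘(ℝ, ℝ).prod (𝓡 3)) (𝓡 4) (⊤ : ℕ∞) F ∧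
  (∀ t, Manifold.IsSmoothEmbedding (𝓡 3) (𝓡 4) (⊤ : ℕ∞) (fun x ↦ F (t, x))) ∧
  (∀ t, 𝓢.metric.IsCauchyHypersurface 𝓢.timeOrientation (range fun x ↦ F (t, x))) ∧
  (∀ t, 𝓢.metric.IsFutureUnitNormal (𝓡 3) 𝓢.timeOrientation (fun x ↦ F (t, x)) (ν t)) ∧
  (∀ t, ∃ Dt : InitialDataSet (𝓡 3) X,
    (∀ (x : X) (v w : TangentSpace (𝓡 3) x), Dt.h.inner x v w =
      𝓢.metric.val (F (t, x)) (mfderiv (𝓡 3) (𝓡 4) (fun y ↦ F (t, y)) x v)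
        (mfderiv (𝓡 3) (𝓡 4) (fun y ↦ F (t, y)) x w)) ∧
    (∀ [𝓢.metric.toPseudoRiemannianMetric.HasLeviCivita] (x : X),
      𝓢.metric.toPseudoRiemannianMetric.secondFundamentalForm (𝓡 3) (fun y ↦ F (t, y)) (ν t) x
        = Dt.kBilin x) ∧
    Dt.IsMaximalData ∧ (∀ [Dt.metric.HasLeviCivita], Dt.IsComplete) ∧
    ∃ e : AFEnd X, e.IsSoleEnd ∧ e.IsAsymptoticallyFlat Dt 1) ∧
  (∀ t x, 0 < 𝓢.lapseOf F ν t x) ∧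
  (∀ t, 0 ≤ t → Tendsto (fun x ↦ 𝓢.lapseOf F ν t x) (cocompact X) (𝓝 1))

variable {𝓢}

/-- Unfolding lemma (definitional, `Iff.rfl`): `IsNormalisedMaximalFoliation` is verbatim the
inline clause "carries a normalised maximal Cauchy foliation" of route `LapseTrumpetKID`, with the
lapse written out as `-g(∂ₜF, ν)`. Christodoulou–Klainerman 1993, Introduction, (1.0.1),
(1.0.10)–(1.0.13). [cite: ChristodoulouKlainerman1993, Introduction, (1.0.1) and (1.0.10)–(1.0.13)] -/
theorem isNormalisedMaximalFoliation_iff (F : ℝ × X → 𝓢.carrier)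
    (ν : ∀ t : ℝ, NormalField (𝓡 4) (fun x : X ↦ F (t, x))) :
    𝓢.IsNormalisedMaximalFoliation F ν ↔
      ContMDiff (𝓘(ℝ, ℝ).prod (𝓡 3)) (𝓡 4) (⊤ : ℕ∞) F ∧
      (∀ t, Manifold.IsSmoothEmbedding (𝓡 3) (𝓡 4) (⊤ : ℕ∞) (fun x ↦ F (t, x))) ∧
      (∀ t, 𝓢.metric.IsCauchyHypersurface 𝓢.timeOrientation (range fun x ↦ F (t, x))) ∧
      (∀ t, 𝓢.metric.IsFutureUnitNormal (𝓡 3) 𝓢.timeOrientation (fun x ↦ F (t, x)) (ν t)) ∧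
      (∀ t, ∃ Dt : InitialDataSet (𝓡 3) X,
        (∀ (x : X) (v w : TangentSpace (𝓡 3) x), Dt.h.inner x v w =
          𝓢.metric.val (F (t, x)) (mfderiv (𝓡 3) (𝓡 4) (fun y ↦ F (t, y)) x v)
            (mfderiv (𝓡 3) (𝓡 4) (fun y ↦ F (t, y)) x w)) ∧
        (∀ [𝓢.metric.toPseudoRiemannianMetric.HasLeviCivita] (x : X),
          𝓢.metric.toPseudoRiemannianMetric.secondFundamentalForm (𝓡 3) (fun y ↦ F (t, y))
            (ν t) x = Dt.kBilin x) ∧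
        Dt.IsMaximalData ∧ (∀ [Dt.metric.HasLeviCivita], Dt.IsComplete) ∧
        ∃ e : AFEnd X, e.IsSoleEnd ∧ e.IsAsymptoticallyFlat Dt 1) ∧
      (∀ t x, 0 < - 𝓢.metric.val (F (t, x))
        (mfderiv 𝓘(ℝ, ℝ) (𝓡 4) (fun s : ℝ ↦ F (s, x)) t 1) (ν t x)) ∧
      (∀ t, 0 ≤ t → Tendsto (fun x ↦ - 𝓢.metric.val (F (t, x))
        (mfderiv 𝓘(ℝ, ℝ) (𝓡 4) (fun s : ℝ ↦ F (s, x)) t 1) (ν t x)) (cocompact X) (𝓝 1)) :=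
  Iff.rfl

namespace IsNormalisedMaximalFoliation

variable {F : ℝ × X → 𝓢.carrier} {ν : ∀ t : ℝ, NormalField (𝓡 4) (fun x : X ↦ F (t, x))}

/-- The foliation map `F : ℝ × X → M` of a normalised maximal Cauchy foliation is smooth.
[cite: ChristodoulouKlainerman1993, Introduction, (1.0.1)] -/
theorem contMDiff (h : 𝓢.IsNormalisedMaximalFoliation F ν) :
    ContMDiff (𝓘(ℝ, ℝ).prod (𝓡 3)) (𝓡 4) ∞ F :=
  h.1

/-- Every leaf map `x ↦ F(t, x)` of a normalised maximal Cauchy foliation is a smooth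
embedding. [cite: ChristodoulouKlainerman1993, Introduction, (1.0.1)] -/
theorem isSmoothEmbedding (h : 𝓢.IsNormalisedMaximalFoliation F ν) (t : ℝ) :
    Manifold.IsSmoothEmbedding (𝓡 3) (𝓡 4) ∞ (fun x ↦ F (t, x)) :=
  h.2.1 t

/-- Every leaf `Σ_t = F({t} × X)` of a normalised maximal Cauchy foliation is a Cauchy
hypersurface. [cite: ChristodoulouKlainerman1993, Introduction, (1.0.1)] -/
theorem isCauchyHypersurface (h : 𝓢.IsNormalisedMaximalFoliation F ν) (t : ℝ) :
    𝓢.metric.IsCauchyHypersurface 𝓢.timeOrientation (range fun x ↦ F (t, x)) :=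
  h.2.2.1 t

/-- `ν t` is the future unit normal of the leaf `x ↦ F(t, x)`.
[cite: ChristodoulouKlainerman1993, Introduction, (1.0.1)] -/
theorem isFutureUnitNormal (h : 𝓢.IsNormalisedMaximalFoliation F ν) (t : ℝ) :
    𝓢.metric.IsFutureUnitNormal (𝓡 3) 𝓢.timeOrientation (fun x ↦ F (t, x)) (ν t) :=
  h.2.2.2.1 t

/-- The data induced on the leaf `Σ_t` agree with a maximal, complete, asymptotically flat
(order `1`, sole end) initial data set on `X`.
[cite: ChristodoulouKlainerman1993, Introduction, (1.0.10)–(1.0.11)] -/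
theorem exists_leafData (h : 𝓢.IsNormalisedMaximalFoliation F ν) (t : ℝ) :
    ∃ Dt : InitialDataSet (𝓡 3) X,
      (∀ (x : X) (v w : TangentSpace (𝓡 3) x), Dt.h.inner x v w =
        𝓢.metric.val (F (t, x)) (mfderiv (𝓡 3) (𝓡 4) (fun y ↦ F (t, y)) x v)
          (mfderiv (𝓡 3) (𝓡 4) (fun y ↦ F (t, y)) x w)) ∧
      (∀ [𝓢.metric.toPseudoRiemannianMetric.HasLeviCivita] (x : X),
        𝓢.metric.toPseudoRiemannianMetric.secondFundamentalForm (𝓡 3) (fun y ↦ F (t, y)) (ν t) x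
          = Dt.kBilin x) ∧
      Dt.IsMaximalData ∧ (∀ [Dt.metric.HasLeviCivita], Dt.IsComplete) ∧
      ∃ e : AFEnd X, e.IsSoleEnd ∧ e.IsAsymptoticallyFlat Dt 1 :=
  h.2.2.2.2.1 t

/-- The lapse of a normalised maximal Cauchy foliation is positive.
[cite: ChristodoulouKlainerman1993, Introduction, (1.0.1)] -/
theorem lapseOf_pos (h : 𝓢.IsNormalisedMaximalFoliation F ν) (t : ℝ) (x : X) :
    0 < 𝓢.lapseOf F ν t x :=
  h.2.2.2.2.2.1 t x

/-- **Normal foliation condition**: on every leaf `t ≥ 0` the lapse tends to `1` at spatial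
infinity (along the cocompact filter of `X`).
[cite: ChristodoulouKlainerman1993, Introduction, Normal Foliation Condition] -/
theorem tendsto_lapseOf (h : 𝓢.IsNormalisedMaximalFoliation F ν) {t : ℝ} (ht : 0 ≤ t) :
    Tendsto (fun x ↦ 𝓢.lapseOf F ν t x) (cocompact X) (𝓝 1) :=
  h.2.2.2.2.2.2 t ht

/-- The leaf maps of a normalised maximal Cauchy foliation are injective (they are embeddings).
[cite: ChristodoulouKlainerman1993, Introduction, (1.0.1)] -/
theorem injective_leaf (h : 𝓢.IsNormalisedMaximalFoliation F ν) (t : ℝ) :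
    Function.Injective fun x ↦ F (t, x) :=
  (h.isSmoothEmbedding t).isEmbedding.injective

end IsNormalisedMaximalFoliation

end Foliation

section TrappedWells

/-- **The lapse wells of `(F, ν)` are trapped**: there are `ε > 0` and a time `t₀` such that for
`t ≥ t₀`, a point `F(t, x)` where the lapse is `< ε` cannot causally reach a point `F(t', x')`,
`t' ≥ t`, where the lapse is `> 1 - ε`: `F(t', x') ∉ J⁺(F(t, x))` ("where time stops is inside a
black hole"). Abstracts the collapse of the lapse of maximal slicings inside black holes
(Beig–Ó Murchadha 1998, §IV); this is the clause "wells trapped" of route `LapseTrumpetKID`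
verbatim (`hasTrappedWells_iff`). [cite: BeigMurchadha1998, §IV] -/
def HasTrappedWells (F : ℝ × X → 𝓢.carrier)
    (ν : ∀ t : ℝ, NormalField (𝓡 4) (fun x : X ↦ F (t, x))) : Prop :=
  ∃ ε : ℝ, 0 < ε ∧ ∃ t₀ : ℝ, ∀ (t : ℝ) (x : X), t₀ ≤ t → 𝓢.lapseOf F ν t x < ε →
    ∀ (t' : ℝ) (x' : X), t ≤ t' → 1 - ε < 𝓢.lapseOf F ν t' x' →
      F (t', x') ∉ 𝓢.metric.causalFuture 𝓢.timeOrientation {F (t, x)}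

variable {𝓢}

/-- Unfolding lemma (definitional, `Iff.rfl`): `HasTrappedWells` is verbatim the inline clause
"wells trapped" of route `LapseTrumpetKID`, with the lapse written out as `-g(∂ₜF, ν)`.
[cite: BeigMurchadha1998, §IV] -/
theorem hasTrappedWells_iff (F : ℝ × X → 𝓢.carrier)
    (ν : ∀ t : ℝ, NormalField (𝓡 4) (fun x : X ↦ F (t, x))) :
    𝓢.HasTrappedWells F ν ↔
      ∃ ε : ℝ, 0 < ε ∧ ∃ t₀ : ℝ, ∀ (t : ℝ) (x : X), t₀ ≤ t →
        - 𝓢.metric.val (F (t, x)) (mfderiv 𝓘(ℝ, ℝ) (𝓡 4) (fun s : ℝ ↦ F (s, x)) t 1) (ν t x)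
          < ε →
        ∀ (t' : ℝ) (x' : X), t ≤ t' →
          1 - ε < - 𝓢.metric.val (F (t', x'))
            (mfderiv 𝓘(ℝ, ℝ) (𝓡 4) (fun s : ℝ ↦ F (s, x')) t' 1) (ν t' x') →
          F (t', x') ∉ 𝓢.metric.causalFuture 𝓢.timeOrientation {F (t, x)} :=
  Iff.rfl

/-- Trapping of the lapse wells is insensitive to shrinking `ε`: if the implication
"lapse `< ε` at `F(t, x)`, `t ≥ t₀`, and lapse `> 1 - ε` at `F(t', x')`, `t' ≥ t` ⟹
`F(t', x') ∉ J⁺(F(t, x))`" holds for some `ε`, then `HasTrappedWells` holds with witness any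
`ε' ∈ (0, ε]` (fewer pairs of points are constrained). [cite: BeigMurchadha1998, §IV] -/
theorem HasTrappedWells.of_le {F : ℝ × X → 𝓢.carrier}
    {ν : ∀ t : ℝ, NormalField (𝓡 4) (fun x : X ↦ F (t, x))} {ε ε' t₀ : ℝ} (hε' : 0 < ε')
    (hle : ε' ≤ ε)
    (h : ∀ (t : ℝ) (x : X), t₀ ≤ t → 𝓢.lapseOf F ν t x < ε →
      ∀ (t' : ℝ) (x' : X), t ≤ t' → 1 - ε < 𝓢.lapseOf F ν t' x' →
        F (t', x') ∉ 𝓢.metric.causalFuture 𝓢.timeOrientation {F (t, x)}) :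
    𝓢.HasTrappedWells F ν :=
  ⟨ε', hε', t₀, fun t x ht hN t' x' htt' hN' ↦
    h t x ht (hN.trans_le hle) t' x' htt' (lt_of_le_of_lt (by linarith) hN')⟩

/-- Under `HasTrappedWells`, eventually in `t`, a collapsed-lapse point `F(t, x)` does not
causally precede any later point of near-unit lapse; spelled with the witnesses extracted.
[cite: BeigMurchadha1998, §IV] -/
theorem HasTrappedWells.exists_forall_not_mem_causalFuture {F : ℝ × X → 𝓢.carrier}
    {ν : ∀ t : ℝ, NormalField (𝓡 4) (fun x : X ↦ F (t, x))} (h : 𝓢.HasTrappedWells F ν) :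
    ∃ ε : ℝ, 0 < ε ∧ ε ≤ 1 ∧ ∃ t₀ : ℝ, ∀ (t : ℝ) (x : X), t₀ ≤ t → 𝓢.lapseOf F ν t x < ε →
      ∀ (t' : ℝ) (x' : X), t ≤ t' → 1 - ε < 𝓢.lapseOf F ν t' x' →
        F (t', x') ∉ 𝓢.metric.causalFuture 𝓢.timeOrientation {F (t, x)} := by
  obtain ⟨ε, hε, t₀, h⟩ := h
  refine ⟨min ε 1, lt_min hε one_pos, min_le_right _ _, t₀, fun t x ht hN t' x' htt' hN' ↦
    h t x ht (hN.trans_le (min_le_left _ _)) t' x' htt' (lt_of_le_of_lt ?_ hN')⟩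
  linarith [min_le_left ε 1]

end TrappedWells

end Spacetime

end Literature.Geometry.Lorentzian

end
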